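import Literature.Geometry.Riemannian.L2HarmonicOneFormsVanishing
import Literature.Geometry.Riemannian.L2HarmonicOneFormsSobolevProofs
import HarnessLib

/-!
# `L²` harmonic `1`-forms under `Ric ≥ 0`: parallelism, constant length, vanishing in infinite
# volume (Carron's habilitation memoir, Prop. 4.1, `k = 1`)

Fifth layer of the proof programme of the named fact
`Literature.Geometry.Riemannian.Carron1999_finrank_l2HarmonicOneForms_le` (Carron 1999 = memoir
Thm. 4.3): the first corollary of the Bochner–Weitzenböck formula `Δ₁ = ∇*∇ + Ric` drawn in the
memoir, §4.a,

> **Prop. 4.1.** *Si `(Mⁿ, g)` est une variété riemannienne connexe complète de volume infini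
> telle que `R_k ≥ 0` alors `Hᵏ(M) = {0}`.* Preuve. — si `α` est une forme harmonique `L²` de
> degré `k`, on peut justifier la formule d'intégration par partie
> `0 = ⟨α, Δ_k α⟩ = ∫_M |∇α|² + ⟨R_k α, α⟩`, ce qui montre que cette forme est forcément
> parallèle et donc sa norme ponctuelle est constante, l'hypothèse sur le volume implique donc
> que cette norme est nulle.

here for `k = 1` (`R_1 = Ric`) on a connected complete Riemannian manifold modelled on `ℝ^m`
(where the tree's Green identity lives), the integration by parts being justified exactly as
printed through the Gaffney cut-offs of `CompleteManifoldCutoff.lean` and the Caccioppoli form of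
the Bochner identity of `HarmonicOneFormBochner.lean`:

* `covDerivOneForm_eq_zero_of_ricci_nonneg` — under `Ric ≥ 0`, every `α ∈ ℋ¹(N, h)` is
  **parallel** (`∇α = 0`) and `Ric(♯α, ♯α) = 0`;
* `innerDual_apply_eq_of_covDerivOneForm_eq_zero` — a parallel `1`-form has **constant length**
  (`d|α|² = 2h⁻¹(∇α, α) = 0` on a connected manifold);
* `l2HarmonicOneForms_eq_bot_of_ricci_nonneg_of_measure_univ_eq_top` — **Prop. 4.1**: if
  moreover `vol(N) = ∞` then `ℋ¹(N, h) = 0`;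
* `l2HarmonicOneForms_eq_bot_of_ricci_nonneg_of_ricci_pos` — the companion (Bochner's
  classical argument): `Ric ≥ 0` everywhere and `Ric > 0` at one point force `ℋ¹(N, h) = 0`.

Everything is proved; no definitions, no named facts (D-0026).

## References

* G. Carron, *Formes harmoniques L² sur les variétés riemanniennes non-compactes*, mémoire
  d'habilitation (1999) = Rend. Mat. Appl. (7) 21 (2001), §4.a, Prop. 4.1 and its proof.
  [`Carron1999HdR`]
* G. Carron, *L² harmonic forms on non-compact Riemannian manifolds*, arXiv:0704.3194 (2007),
  proof of Cor. 2.12 ("`α` has constant length … the volume of `(M, g)` is infinite and `α = 0`").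
  [`Carron2007`]
-/

noncomputable section

open Bundle Set Function Filter FiberBundle
open scoped Manifold ContDiff Topology ENNReal NNReal

namespace Literature.Geometry.Riemannian

open _root_.MeasureTheory Literature.Geometry.Lorentzian

section NonnegRicci

universe uH uN

variable {m : ℕ} {H' : Type uH} [TopologicalSpace H']
  {J : ModelWithCorners ℝ (EuclideanSpace ℝ (Fin m)) H'} [J.Boundaryless]
  {N : Type uN} [TopologicalSpace N] [ChartedSpace H' N] [IsManifold J ∞ N]
  [T3Space N] [SecondCountableTopology N] [MeasurableSpace N] [BorelSpace N] [ConnectedSpace N]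
  (h : ContMDiffRiemannianMetric J ∞ (EuclideanSpace ℝ (Fin m)) (TangentSpace J : N → Type _))
  [(PseudoRiemannianMetric.ofRiemannian h).HasLeviCivita]

/-- **`L²` harmonic `1`-forms are parallel when `Ric ≥ 0`** (Carron 1999HdR, §4.a, proof of
Prop. 4.1: "`0 = ∫_M |∇α|² + ⟨R_k α, α⟩` … cette forme est forcément parallèle"). On a connected
complete Riemannian manifold modelled on `ℝ^m` with `Ric_h ≥ 0`, every `α ∈ ℋ¹(N, h)` has
`∇α = 0` and `Ric(♯α, ♯α) = 0` everywhere. Proof: with the Gaffney cut-offs `χ_k`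
(`|dχ_k|² ≤ C₀/(k+1)²`), the Caccioppoli inequality
`∫ χ_k²|∇α|² ≤ 4∫|dχ_k|²|α|² - 2∫χ_k² Ric(♯α,♯α) ≤ 4 C₀ ‖α‖²_{L²}/(k+1)²` and Fatou give
`∫ |∇α|² = 0 = ∫ Ric(♯α, ♯α)`, and both integrands are continuous and nonnegative.
[cite: Carron1999HdR, §4.a, Prop. 4.1 (proof)] -/
theorem covDerivOneForm_eq_zero_of_ricci_nonneg
    (hRic : ∀ (y : N) (v : TangentSpace J y), 0 ≤ (PseudoRiemannianMetric.ofRiemannian h).ricci y v v)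
    (hc : IsGeodesicallyComplete (PseudoRiemannianMetric.ofRiemannian h).leviCivita)
    {α : Π x : N, TangentSpace J x →L[ℝ] ℝ} (hα : α ∈ l2HarmonicOneForms h) :
    (∀ y, (PseudoRiemannianMetric.ofRiemannian h).covDerivOneForm α y = 0) ∧
      ∀ y, (PseudoRiemannianMetric.ofRiemannian h).ricci y
        ((PseudoRiemannianMetric.ofRiemannian h).sharp y (α y).toLinearMap)
        ((PseudoRiemannianMetric.ofRiemannian h).sharp y (α y).toLinearMap) = 0 := by
  classical
  haveI : LocallyCompactSpace N := Manifold.locallyCompact_of_finiteDimensional J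
  haveI : (riemannianMeasure h).IsOpenPosMeasure := isOpenPosMeasure_riemannianMeasure h
  set G := PseudoRiemannianMetric.ofRiemannian h with hG
  set ν := riemannianMeasure h with hν
  have hg : G.IsRiemannian := PseudoRiemannianMetric.isRiemannian_ofRiemannian h
  obtain ⟨hs, hL2, hsy, htr⟩ := (mem_l2HarmonicOneForms_iff h).1 hα
  -- the empty manifold
  rcases isEmpty_or_nonempty N with hN | ⟨⟨o⟩⟩
  · exact ⟨fun y ↦ (IsEmpty.false y).elim, fun y ↦ (IsEmpty.false y).elim⟩
  -- the pointwise quantities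
  set Nα : N → ℝ := fun y ↦ G.innerDual y (α y).toLinearMap (α y).toLinearMap with hNα
  set Q : N → ℝ := fun y ↦ G.normSq y (G.covDerivOneForm α y) with hQ
  set Rc : N → ℝ := fun y ↦ G.ricci y (G.sharp y (α y).toLinearMap) (G.sharp y (α y).toLinearMap)
    with hRc
  have hNα0 : ∀ y, 0 ≤ Nα y := fun y ↦ innerDual_self_nonneg (h := h) y _
  have hQ0 : ∀ y, 0 ≤ Q y := fun y ↦ G.normSq_nonneg y hg _
  have hRc0 : ∀ y, 0 ≤ Rc y := fun y ↦ hRic y _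
  -- regularity
  have hNs : ContMDiff J 𝓘(ℝ, ℝ) ∞ Nα := fun y ↦ contMDiffAt_innerDual_oneForm G (hs y) (hs y)
  have hNc : Continuous Nα := hNs.continuous
  have hQs : ContMDiff J 𝓘(ℝ, ℝ) ∞ Q := fun y ↦
    contMDiffAt_normSq_covDerivOneForm G isOpen_univ (mem_univ y) (fun z _ ↦ hs z) (fun z _ ↦ hsy z)
  have hQc : Continuous Q := hQs.continuous
  have hBochner : ∀ y, G.dalembertian Nα y = 2 * Q y + 2 * Rc y := fun y ↦
    dalembertian_innerDual_eq_of_mem_l2HarmonicOneForms h hα y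
  have hRcc : Continuous Rc := by
    have hN2 : CMDiff 2 Nα := hNs.of_le (WithTop.coe_le_coe.mpr le_top)
    have : Rc = fun y ↦ (G.dalembertian Nα y - 2 * Q y) / 2 := by
      funext y; rw [hBochner y]; ring
    rw [this]
    exact ((continuous_dalembertian G hN2).sub (continuous_const.mul hQc)).div_const _
  -- `|α|² ∈ L¹`
  have hNint : Integrable Nα ν := by
    refine ⟨hNc.aestronglyMeasurable, ?_⟩
    rw [hasFiniteIntegral_iff_ofReal (ae_of_all _ hNα0)]
    exact hL2
  set IN : ℝ := ∫ y, Nα y ∂ν with hIN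
  have hIN0 : 0 ≤ IN := integral_nonneg hNα0
  -- the cut-offs
  obtain ⟨C₀, χ, hχs, hχk, hχ0, hχ1, -, hχev, hχgrad⟩ :
      ∃ (C₀ : ℝ) (χ : ℕ → N → ℝ), (∀ k, ContMDiff J 𝓘(ℝ, ℝ) ∞ (χ k)) ∧
        (∀ k, HasCompactSupport (χ k)) ∧ (∀ k y, 0 ≤ χ k y) ∧ (∀ k y, χ k y ≤ 1) ∧
        (∀ (k : ℕ) (y : N), G.edist hg o y < ENNReal.ofReal (((k : ℝ) + 1) / 2) → χ k y = 1) ∧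
        (∀ y, ∀ᶠ k in atTop, χ k y = 1) ∧
        ∀ k y, G.gradSq (χ k) y ≤ C₀ / ((k : ℝ) + 1) ^ 2 := by
    obtain ⟨C₀, hC₀⟩ := exists_cutoff_seq_of_isGeodesicallyComplete.{0, uH, uN}
    exact ⟨C₀, hC₀ J N G hg hc o⟩
  have hC₀ : 0 ≤ C₀ := by
    have h1 := hχgrad 0 o
    have h2 : 0 ≤ G.gradSq (χ 0) o := G.gradSq_nonneg hg _ _
    have h3 : C₀ / ((0 : ℕ) + 1 : ℝ) ^ 2 = C₀ := by norm_num
    linarith [h3 ▸ h1]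
  have hχc : ∀ k, Continuous (χ k) := fun k ↦ (hχs k).continuous
  have hzero : ∀ k, ∀ y ∉ tsupport (χ k), χ k y = 0 := fun k y hy ↦
    image_eq_zero_of_notMem_tsupport hy
  have hgradc : ∀ k, Continuous (G.gradSq (χ k)) := fun k ↦
    continuous_innerDual_mvfderiv G ((hχs k).of_le (by norm_num)) ((hχs k).of_le (by norm_num))
  -- the Caccioppoli inequality for `χ k`
  set A : ℕ → ℝ := fun k ↦ ∫ y, χ k y ^ 2 * Q y ∂ν with hA
  set B : ℕ → ℝ := fun k ↦ ∫ y, G.gradSq (χ k) y * Nα y ∂ν with hB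
  set R : ℕ → ℝ := fun k ↦ ∫ y, χ k y ^ 2 * Rc y ∂ν with hR
  have hIA : ∀ k, Integrable (fun y ↦ χ k y ^ 2 * Q y) ν := fun k ↦
    integrable_of_continuous_of_hasCompactSupport h (((hχc k).pow 2).mul hQc)
      (HasCompactSupport.intro (hχk k) fun y hy ↦ by simp [hzero k y hy])
  have hIB : ∀ k, Integrable (fun y ↦ G.gradSq (χ k) y * Nα y) ν := fun k ↦
    integrable_of_continuous_of_hasCompactSupport h ((hgradc k).mul hNc)
      (HasCompactSupport.intro (hχk k) fun y hy ↦ by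
        rw [PseudoRiemannianMetric.gradSq, mvfderiv_eq_zero_of_notMem_tsupport hy]
        simp [PseudoRiemannianMetric.innerDual])
  have hIR : ∀ k, Integrable (fun y ↦ χ k y ^ 2 * Rc y) ν := fun k ↦
    integrable_of_continuous_of_hasCompactSupport h (((hχc k).pow 2).mul hRcc)
      (HasCompactSupport.intro (hχk k) fun y hy ↦ by simp [hzero k y hy])
  have hCacc : ∀ k, A k ≤ 4 * B k - 2 * R k := fun k ↦
    integral_sq_mul_normSq_covDerivOneForm_le h hα (hχs k) (hχk k)
  have hA0 : ∀ k, 0 ≤ A k := fun k ↦ integral_nonneg fun y ↦ mul_nonneg (sq_nonneg _) (hQ0 y)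
  have hR0 : ∀ k, 0 ≤ R k := fun k ↦ integral_nonneg fun y ↦ mul_nonneg (sq_nonneg _) (hRc0 y)
  have hBle : ∀ k, B k ≤ C₀ / ((k : ℝ) + 1) ^ 2 * IN := by
    intro k
    rw [hIN, ← integral_const_mul]
    exact integral_mono (hIB k) (hNint.const_mul _) fun y ↦
      mul_le_mul_of_nonneg_right (hχgrad k y) (hNα0 y)
  set b : ℕ → ℝ := fun k ↦ 4 * (C₀ / ((k : ℝ) + 1) ^ 2 * IN) with hb
  have hAb : ∀ k, A k ≤ b k := fun k ↦ by simp only [hb]; linarith [hCacc k, hBle k, hR0 k]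
  have hRb : ∀ k, R k ≤ b k := fun k ↦ by
    have : 0 ≤ C₀ / ((k : ℝ) + 1) ^ 2 * IN := by positivity
    simp only [hb]; linarith [hCacc k, hBle k, hA0 k]
  have hbt : Tendsto b atTop (𝓝 0) := by
    have h1 : Tendsto (fun k : ℕ ↦ ((k : ℝ) + 1) ^ 2) atTop atTop := by
      refine (tendsto_pow_atTop two_ne_zero).comp ?_
      exact tendsto_atTop_add_const_right _ 1 tendsto_natCast_atTop_atTop
    have h2 : Tendsto (fun k : ℕ ↦ C₀ / ((k : ℝ) + 1) ^ 2 * IN) atTop (𝓝 0) := by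
      have := (tendsto_const_nhds (x := C₀)).div_atTop h1
      simpa using this.mul_const IN
    simpa [hb] using h2.const_mul 4
  -- Fatou: a continuous `F ≥ 0` with `∫ χ_k² F ≤ b_k → 0` vanishes identically
  have key : ∀ F : N → ℝ, Continuous F → (∀ y, 0 ≤ F y) →
      (∀ k, Integrable (fun y ↦ χ k y ^ 2 * F y) ν) →
      (∀ k, ∫ y, χ k y ^ 2 * F y ∂ν ≤ b k) → ∀ y, F y = 0 := by
    intro F hFc hF0 hFi hFb
    have hmeas : ∀ k, Measurable fun y ↦ ENNReal.ofReal (χ k y ^ 2 * F y) := fun k ↦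
      (((hχc k).pow 2).mul hFc).measurable.ennreal_ofReal
    have hev : ∀ y, ∀ᶠ k in atTop, ENNReal.ofReal (χ k y ^ 2 * F y) = ENNReal.ofReal (F y) :=
      fun y ↦ (hχev y).mono fun k hk ↦ by rw [hk, one_pow, one_mul]
    have hle : ∀ k, ∫⁻ y, ENNReal.ofReal (χ k y ^ 2 * F y) ∂ν ≤ ENNReal.ofReal (b k) := by
      intro k
      rw [← ofReal_integral_eq_lintegral_ofReal (hFi k)
        (ae_of_all _ fun y ↦ mul_nonneg (sq_nonneg _) (hF0 y))]
      exact ENNReal.ofReal_le_ofReal (hFb k)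
    have hlim : Tendsto (fun k ↦ ∫⁻ y, ENNReal.ofReal (χ k y ^ 2 * F y) ∂ν) atTop (𝓝 0) := by
      refine tendsto_of_tendsto_of_tendsto_of_le_of_le tendsto_const_nhds ?_ (fun _ ↦ zero_le) hle
      rw [← ENNReal.ofReal_zero]
      exact ENNReal.tendsto_ofReal hbt
    have hzeroInt : ∫⁻ y, ENNReal.ofReal (F y) ∂ν = 0 := by
      refine le_antisymm ?_ zero_le
      calc ∫⁻ y, ENNReal.ofReal (F y) ∂ν
          ≤ liminf (fun k ↦ ∫⁻ y, ENNReal.ofReal (χ k y ^ 2 * F y) ∂ν) atTop :=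
            lintegral_le_liminf_of_eventually_eq ν hmeas hev
        _ = 0 := hlim.liminf_eq
    have hae : (fun y ↦ ENNReal.ofReal (F y)) =ᵐ[ν] 0 :=
      (lintegral_eq_zero_iff hFc.measurable.ennreal_ofReal).1 hzeroInt
    have hFae : F =ᵐ[ν] fun _ ↦ (0 : ℝ) := by
      filter_upwards [hae] with y hy
      exact le_antisymm (ENNReal.ofReal_eq_zero.1 hy) (hF0 y)
    have hF : F = fun _ ↦ (0 : ℝ) := (Continuous.ae_eq_iff_eq ν hFc continuous_const).1 hFae
    exact fun y ↦ congrFun hF y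
  have hQz : ∀ y, Q y = 0 := key Q hQc hQ0 hIA hAb
  have hRz : ∀ y, Rc y = 0 := key Rc hRcc hRc0 hIR hRb
  exact ⟨fun y ↦ (G.normSq_eq_zero_iff y hg _).1 (hQz y), hRz⟩

omit [T3Space N] [SecondCountableTopology N] [MeasurableSpace N] [BorelSpace N] in
/-- **A parallel `1`-form has constant length** on a connected manifold: `d|α|²(v) =
2 h⁻¹(∇_v α, α) = 0` (`mvfderiv_innerDual_self`), and a function with vanishing differential is
constant (`apply_eq_of_mvfderiv_eq_zero`). Carron 1999HdR, §4.a, proof of Prop. 4.1 ("cette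
forme est forcément parallèle et donc sa norme ponctuelle est constante").
[cite: Carron1999HdR, §4.a, Prop. 4.1 (proof)] -/
theorem innerDual_apply_eq_of_covDerivOneForm_eq_zero {α : Π x : N, TangentSpace J x →L[ℝ] ℝ}
    (hs : ∀ x, ContMDiffAt J (J.prod 𝓘(ℝ, EuclideanSpace ℝ (Fin m) →L[ℝ] ℝ)) ∞ (oneFormSection α) x)
    (hpar : ∀ y, (PseudoRiemannianMetric.ofRiemannian h).covDerivOneForm α y = 0) (x y : N) :
    (PseudoRiemannianMetric.ofRiemannian h).innerDual x (α x).toLinearMap (α x).toLinearMap =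
      (PseudoRiemannianMetric.ofRiemannian h).innerDual y (α y).toLinearMap (α y).toLinearMap := by
  set G := PseudoRiemannianMetric.ofRiemannian h
  set Nα : N → ℝ := fun y ↦ G.innerDual y (α y).toLinearMap (α y).toLinearMap with hNα
  have hNs : ContMDiff J 𝓘(ℝ, ℝ) ∞ Nα := fun y ↦ contMDiffAt_innerDual_oneForm G (hs y) (hs y)
  have hd : ∀ z, MDiffAt Nα z := fun z ↦ (hNs z).mdifferentiableAt (by simp)
  have h0 : ∀ z, mvfderiv J Nα z = 0 := by
    intro z
    ext v
    have := mvfderiv_innerDual_self h le_rfl (by exact_mod_cast le_top) (hs z) v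
    simp only [hNα]
    rw [this, hpar z]
    simp [PseudoRiemannianMetric.innerDual]
  exact apply_eq_of_mvfderiv_eq_zero hd h0 x y

/-- **Carron 1999HdR, Prop. 4.1 (`k = 1`): on a connected complete Riemannian manifold of
infinite volume with `Ric ≥ 0`, every `L²` harmonic `1`-form vanishes** — "Si `(Mⁿ, g)` est une
variété riemannienne connexe complète de volume infini telle que `R_k ≥ 0` alors `Hᵏ(M) = {0}`"
(here `k = 1`, `R_1 = Ric`, `ℋ¹` the smooth `L²` covector fields with `∇α` symmetric and
trace-free, on a manifold modelled on `ℝ^m`). Proof as printed: `α` is parallel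
(`covDerivOneForm_eq_zero_of_ricci_nonneg`), hence `|α|²` is a constant `c`
(`innerDual_apply_eq_of_covDerivOneForm_eq_zero`), and `∫ |α|² = c · vol(N) < ∞` with
`vol(N) = ∞` forces `c = 0`. [cite: Carron1999HdR, §4.a, Prop. 4.1] -/
theorem l2HarmonicOneForms_eq_bot_of_ricci_nonneg_of_measure_univ_eq_top
    (hRic : ∀ (y : N) (v : TangentSpace J y), 0 ≤ (PseudoRiemannianMetric.ofRiemannian h).ricci y v v)
    (hc : IsGeodesicallyComplete (PseudoRiemannianMetric.ofRiemannian h).leviCivita)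
    (hvol : riemannianMeasure h (univ : Set N) = ⊤) :
    l2HarmonicOneForms h = ⊥ := by
  rw [Submodule.eq_bot_iff]
  intro α hα
  set G := PseudoRiemannianMetric.ofRiemannian h with hG
  obtain ⟨hs, hL2, -, -⟩ := (mem_l2HarmonicOneForms_iff h).1 hα
  obtain ⟨hpar, -⟩ := covDerivOneForm_eq_zero_of_ricci_nonneg h hRic hc hα
  rcases isEmpty_or_nonempty N with hN | ⟨⟨o⟩⟩
  · funext y; exact (IsEmpty.false y).elim
  set c : ℝ := G.innerDual o (α o).toLinearMap (α o).toLinearMap with hc'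
  have hconst : ∀ y, G.innerDual y (α y).toLinearMap (α y).toLinearMap = c := fun y ↦
    innerDual_apply_eq_of_covDerivOneForm_eq_zero h hs hpar y o
  have hc0 : 0 ≤ c := innerDual_self_nonneg (h := h) o _
  -- `c = 0`, for otherwise `∫ |α|² = c · vol(N) = ∞`
  have hcz : c = 0 := by
    by_contra hne
    have hpos : 0 < c := lt_of_le_of_ne hc0 (Ne.symm hne)
    have hI : ∫⁻ y, ENNReal.ofReal (G.innerDual y (α y).toLinearMap (α y).toLinearMap)
        ∂riemannianMeasure h = ENNReal.ofReal c * riemannianMeasure h (univ : Set N) := by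
      simp_rw [hconst]
      rw [lintegral_const]
    rw [hI, hvol, ENNReal.mul_top (by simpa using hpos)] at hL2
    exact lt_irrefl _ hL2
  funext y
  exact eq_zero_of_innerDual_self_eq_zero h y (α y) (by rw [hconst y, hcz])

/-- **Bochner's argument: `Ric ≥ 0`, and `Ric > 0` at one point, force `ℋ¹ = 0`** on a connected
complete Riemannian manifold (modelled on `ℝ^m`): an `L²` harmonic `1`-form is parallel with
`Ric(♯α, ♯α) = 0` and constant length (`covDerivOneForm_eq_zero_of_ricci_nonneg`,
`innerDual_apply_eq_of_covDerivOneForm_eq_zero`); at a point where `Ric` is positive definite this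
gives `♯α = 0`, so the constant length is `0`. [folklore] -/
theorem l2HarmonicOneForms_eq_bot_of_ricci_nonneg_of_ricci_pos
    (hRic : ∀ (y : N) (v : TangentSpace J y), 0 ≤ (PseudoRiemannianMetric.ofRiemannian h).ricci y v v)
    {y₀ : N} (hpos : ∀ v : TangentSpace J y₀, v ≠ 0 →
      0 < (PseudoRiemannianMetric.ofRiemannian h).ricci y₀ v v)
    (hc : IsGeodesicallyComplete (PseudoRiemannianMetric.ofRiemannian h).leviCivita) :
    l2HarmonicOneForms h = ⊥ := by
  rw [Submodule.eq_bot_iff]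
  intro α hα
  set G := PseudoRiemannianMetric.ofRiemannian h with hG
  obtain ⟨hs, -, -, -⟩ := (mem_l2HarmonicOneForms_iff h).1 hα
  obtain ⟨hpar, hRc⟩ := covDerivOneForm_eq_zero_of_ricci_nonneg h hRic hc hα
  -- at `y₀`: `Ric(♯α, ♯α) = 0` with `Ric_{y₀} > 0` gives `♯α(y₀) = 0`, i.e. `α(y₀) = 0`
  have hsharp : G.sharp y₀ (α y₀).toLinearMap = 0 := by
    by_contra hne
    exact (hpos _ hne).ne' (hRc y₀)
  have hα0 : G.innerDual y₀ (α y₀).toLinearMap (α y₀).toLinearMap = 0 := by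
    rw [G.innerDual_eq_val_sharp_sharp, hsharp]; simp
  funext y
  exact eq_zero_of_innerDual_self_eq_zero h y (α y)
    (by rw [innerDual_apply_eq_of_covDerivOneForm_eq_zero h hs hpar y y₀, hα0])

end NonnegRicci

end Literature.Geometry.Riemannian

end
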